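import Summits.QuantumFields.QCD.Theorems.QuarksAsStableActionStableActionBridgeTransferLevelBounds
import Summits.QuantumFields.QCD.Theorems.QuarksAsStableActionStableActionBridgeSliceGaugeUnitarity

/-!
# The completely filled slice state: a second exact eigen-wave of the fermionic transfer operator
(crux `HeatSlicedQuarks.RobustYangMillsHandover`, item stmt-QuantumFields-8892, line `pin-the-infimum`;
helper towards the held stub `stub_spectralResponse` and the dictionary stub, both stated over
`qcdTransferGap = Real.log λ₀ − Real.log λ₁` of `Literature/…/QCDTransferMatrix.lean`)

The two spectral stubs of the line read Lüscher's finite-volume transfer-matrix gap through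
`qcdTransferGap N_f β S m = log λ₀ − log λ₁`, `λₙ = qcdTransferLevel … n` the min–max levels.  The tree
knows `0 < λ₀`, `λ₁ ≤ λ₀` and `0 ≤ λ₁` (StableActionBridge leads, `qcdTransferLevel_zero_pos_and_le`,
`qcdTransferLevel_antitone`), but NOT `0 < λ₁`; with `Real.log 0 = 0` the gap would silently be the junk
value `log λ₀` wherever `λ₁ = 0`.  The next file proves `0 < λ₁` (for `N_f ≥ 1`, `β ≥ 0`, `m_f > −1`); this
file supplies its second trial wave: the constant wave `Ξ : U ↦ |ι⟩` with ALL slice quark modes occupied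
(the top exterior power), next to the constant vacuum wave `Ω : U ↦ |∅⟩`.

* `fockLift_mulVec_filled`: `Γ(X)|ι⟩ = det X · |ι⟩` (the only `#ι × #ι` minor is `det X`; smaller
  occupation sets have the wrong cardinality);
* `det_sliceGaugeRot`: the one-particle gauge rotation `R_c ⊗ 1` has determinant `1` (`R_c` is block
  diagonal with `SU(3)` blocks), hence `Γ(G_g)|ι⟩ = |ι⟩` (`fockGaugeAct_mulVec_filled`) and every constant
  combination `U ↦ a|∅⟩ + b|ι⟩` is a continuous gauge-invariant wave, i.e. lies in `transferCore`;
* `fermionSliceOp_mulVec_filled`: `T̂_F(U)|ι⟩ = T̂_F(U)_{ιι} · |ι⟩` with `T̂_F(U)_{ιι}` real, `> 0`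
  (diagonal entry of the positive definite `T̂_F(U)`, `fermionSliceOp_posDef`) and continuous in `U`;
* the Fock pairings of the two basis waves (`⟨∅|ι⟩ = 0` needs one quark mode, i.e. `N_f ≥ 1`).

References: M. Lüscher, Commun. Math. Phys. 54 (1977) 283 [Luscher1977, pp. 283–292]; J. Smit,
*Introduction to Quantum Fields on a Lattice*, §6.5 (6.87)–(6.91) [Smit2023]; M. Reed, B. Simon,
*Methods of Modern Mathematical Physics IV*, Thm XIII.1 [ReedSimonIV1978].  Pure theorem file.
-/

noncomputable section

namespace Summit.QuantumFields.QCD.Cruxes.RobustYangMillsHandover.PinTheInfimum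

open scoped ComplexOrder
open MeasureTheory Matrix Literature.MathematicalPhysics.QuantumFieldTheory
  Literature.MathematicalPhysics.QuantumLattice
open Summit.QuantumFields.QCD.Cruxes.StableActionBridge.Sketch
open Literature.Probability.LatticeModels (TorusSite)

namespace FilledSliceState

/-! ### `Γ(X)` on the completely filled state -/

section FockLift

variable {ι : Type*} [LinearOrder ι] [Fintype ι]

/-- The increasing enumeration of `Finset.univ` is a bijection `Fin #ι → ι`. [folklore] -/
theorem bijective_orderEmbOfFin_univ (h : (Finset.univ : Finset ι).card = (Finset.univ : Finset ι).card) :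
    Function.Bijective ((Finset.univ : Finset ι).orderEmbOfFin h) := by
  refine ⟨((Finset.univ : Finset ι).orderEmbOfFin h).injective, ?_⟩
  rw [← Set.range_eq_univ, Finset.range_orderEmbOfFin, Finset.coe_univ]

/-- The diagonal entry of `Γ(X)` at the completely filled state is `det X`. [folklore] -/
theorem fockLift_apply_univ_univ (X : Matrix ι ι ℂ) :
    fockLift X Finset.univ Finset.univ = X.det := by
  rw [fockLift, Matrix.of_apply, dif_pos rfl]
  exact Matrix.det_submatrix_equiv_self (Equiv.ofBijective _ (bijective_orderEmbOfFin_univ rfl)) X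

/-- Off the filled state the column of `Γ(X)` at the filled state vanishes (cardinality mismatch).
[folklore] -/
theorem fockLift_apply_univ_of_ne (X : Matrix ι ι ℂ) {s : Finset ι} (hs : s ≠ Finset.univ) :
    fockLift X s Finset.univ = 0 := by
  rw [fockLift, Matrix.of_apply, dif_neg]
  intro h
  have hlt : s.card < (Finset.univ : Finset ι).card :=
    Finset.card_lt_card (Finset.ssubset_univ_iff.mpr hs)
  omega

/-- **`Γ(X)|ι⟩ = det X · |ι⟩`**: the completely filled state is an eigenvector of every second-quantised
one-particle matrix, with eigenvalue the determinant (top exterior power). [cite: Smit2023, App. C (C.62)] -/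
theorem fockLift_mulVec_filled (X : Matrix ι ι ℂ) :
    fockLift X *ᵥ (Pi.single (Finset.univ : Finset ι) (1 : ℂ)) =
      X.det • Pi.single (Finset.univ : Finset ι) (1 : ℂ) := by
  rw [Matrix.mulVec_single_one]
  funext s
  rw [Matrix.col_apply, Pi.smul_apply, Pi.single_apply]
  by_cases hs : s = Finset.univ
  · subst hs
    rw [if_pos rfl, fockLift_apply_univ_univ, smul_eq_mul, mul_one]
  · rw [if_neg hs, fockLift_apply_univ_of_ne X hs, smul_zero]

end FockLift

/-! ### The gauge rotation has determinant one; the filled wave is gauge invariant -/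

variable {Nf S : ℕ} [NeZero S]

/-- The spin-blind colour rotation `R_c (f,x,a) (f',x',b) = δ_{ff'} δ_{xx'} g(x)_{ab}` has determinant `1`
(block diagonal with `SU(3)` blocks). [cite: Smit2023, §4.6 (4.124)–(4.126)] -/
theorem det_colourRot (g : TorusSite 3 S → Matrix.specialUnitaryGroup (Fin 3) ℂ) :
    (Matrix.of fun p q : SliceColourVar Nf S =>
        if p.1 = q.1 ∧ p.2.1 = q.2.1 then (g p.2.1 : Matrix (Fin 3) (Fin 3) ℂ) p.2.2 q.2.2 else 0).det = 1 := by
  rw [SliceGaugeUnitarity.colourRot_eq_submatrix_blockDiagonal, Matrix.det_submatrix_equiv_self,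
    Matrix.det_blockDiagonal]
  exact Finset.prod_eq_one fun k _ => (g k.2).2.2

/-- **The one-particle gauge rotation of the slice quark modes has determinant one**:
`det (R_c ⊗ 1) = (det R_c)⁴ = 1`. [cite: Smit2023, §4.6 (4.124)–(4.126)] -/
theorem det_sliceGaugeRot (g : TorusSite 3 S → Matrix.specialUnitaryGroup (Fin 3) ℂ) :
    (sliceGaugeRot (Nf := Nf) g).det = 1 := by
  rw [sliceGaugeRot, SliceNilpotent.det_sliceKron, det_colourRot, Matrix.det_one, one_pow, one_pow,
    one_mul]

/-- **`Γ(G_g)|ι⟩ = |ι⟩`**: the completely filled slice state is invariant under every time-independent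
gauge transformation (its eigenvalue is `det G_g = 1`). [cite: Smit2023, §4.6 (4.125)–(4.127)] -/
theorem fockGaugeAct_mulVec_filled (g : TorusSite 3 S → Matrix.specialUnitaryGroup (Fin 3) ℂ) :
    fockGaugeAct (Nf := Nf) (S := S) g *ᵥ Pi.single (Finset.univ : Finset (SliceFermiIdx Nf S)) (1 : ℂ) =
      Pi.single (Finset.univ : Finset (SliceFermiIdx Nf S)) (1 : ℂ) := by
  rw [fockGaugeAct, fockLift_mulVec_filled, Matrix.reindex_apply, Matrix.det_submatrix_equiv_self,
    det_sliceGaugeRot, one_smul]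

/-- `Γ(G_g)|∅⟩ = |∅⟩` (the Fock vacuum is gauge invariant). [folklore] -/
theorem fockGaugeAct_mulVec_vacuum (g : TorusSite 3 S → Matrix.specialUnitaryGroup (Fin 3) ℂ) :
    fockGaugeAct (Nf := Nf) (S := S) g *ᵥ (vacuum : Fock (SliceFermiIdx Nf S)) = vacuum := by
  rw [fockGaugeAct]
  exact fockLift_mulVec_vacuum _

/-- **Constant combinations of the vacuum and the filled state are core waves**: for all `a b : ℂ` the
constant wave `U ↦ a|∅⟩ + b|ι⟩` is continuous and gauge invariant, i.e. lies in `transferCore`. [folklore] -/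
theorem constWave_mem_transferCore (a b : ℂ) :
    (fun _ : GaugeConfig 3 S (Matrix.specialUnitaryGroup (Fin 3) ℂ) =>
        a • (vacuum : Fock (SliceFermiIdx Nf S)) +
          b • Pi.single (Finset.univ : Finset (SliceFermiIdx Nf S)) (1 : ℂ)) ∈ transferCore Nf S := by
  refine ⟨continuous_const, fun g U => ?_⟩
  rw [Matrix.mulVec_add, Matrix.mulVec_smul, Matrix.mulVec_smul, fockGaugeAct_mulVec_vacuum,
    fockGaugeAct_mulVec_filled]

/-! ### `T̂_F(U)` on the filled state -/

/-- **`T̂_F(U)|ι⟩ = T̂_F(U)_{ιι} · |ι⟩`**: the completely filled state is an eigenvector of the fermionic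
transfer operator in every background (`T̂_F = (det A)² Γ(M_F)` and `Γ(M_F)|ι⟩ = det M_F |ι⟩`).
[cite: Smit2023, §6.5 (6.91)] -/
theorem fermionSliceOp_mulVec_filled (U : GaugeConfig 3 S (Matrix.specialUnitaryGroup (Fin 3) ℂ))
    (mq : Fin Nf → ℝ) :
    fermionSliceOp U mq *ᵥ Pi.single (Finset.univ : Finset (SliceFermiIdx Nf S)) (1 : ℂ) =
      (fermionSliceOp U mq Finset.univ Finset.univ) •
        Pi.single (Finset.univ : Finset (SliceFermiIdx Nf S)) (1 : ℂ) := by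
  have h : fermionSliceOp U mq *ᵥ Pi.single (Finset.univ : Finset (SliceFermiIdx Nf S)) (1 : ℂ) =
      (((sliceMassHop U mq).det ^ 2) *
          (Matrix.reindex sliceQuarkEquiv sliceQuarkEquiv (fermionSliceMatrix U mq)).det) •
        Pi.single (Finset.univ : Finset (SliceFermiIdx Nf S)) (1 : ℂ) := by
    rw [fermionSliceOp, Matrix.smul_mulVec, fockLift_mulVec_filled, smul_smul]
  have hdiag : fermionSliceOp U mq Finset.univ Finset.univ =
      ((sliceMassHop U mq).det ^ 2) *
        (Matrix.reindex sliceQuarkEquiv sliceQuarkEquiv (fermionSliceMatrix U mq)).det := by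
    have := congrFun h Finset.univ
    simpa [Matrix.mulVec_single_one, Matrix.col_apply] using this
  rw [h, hdiag]

/-- The filled-state eigenvalue `T̂_F(U)_{ιι}` is a strictly positive real number for `m_f > −1`
(diagonal entry of the positive definite `T̂_F(U)`). [cite: Luscher1977, pp. 283–292] -/
theorem fermionSliceOp_univ_univ_pos (U : GaugeConfig 3 S (Matrix.specialUnitaryGroup (Fin 3) ℂ))
    (mq : Fin Nf → ℝ) (hm : ∀ f, -1 < mq f) :
    0 < (fermionSliceOp U mq Finset.univ Finset.univ).re ∧
      (fermionSliceOp U mq Finset.univ Finset.univ).im = 0 := by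
  have h : (0 : ℂ) < fermionSliceOp U mq Finset.univ Finset.univ :=
    (fermionSliceOp_posDef Nf S U mq hm).diag_pos
  rw [Complex.pos_iff] at h
  exact ⟨h.1, h.2.symm⟩

/-- The filled-state eigenvalue is the complexification of its real part (`m_f > −1`). [folklore] -/
theorem ofReal_fermionSliceOp_univ_univ_re (U : GaugeConfig 3 S (Matrix.specialUnitaryGroup (Fin 3) ℂ))
    (mq : Fin Nf → ℝ) (hm : ∀ f, -1 < mq f) :
    (((fermionSliceOp U mq Finset.univ Finset.univ).re : ℝ) : ℂ) =
      fermionSliceOp U mq Finset.univ Finset.univ :=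
  Complex.ext (Complex.ofReal_re _)
    (by rw [Complex.ofReal_im, (fermionSliceOp_univ_univ_pos U mq hm).2])

/-- The real filled-state eigenvalue `U ↦ Re T̂_F(U)_{ιι}` is continuous in the background. [folklore] -/
theorem continuous_fermionSliceOp_univ_univ_re (mq : Fin Nf → ℝ) (hm : ∀ f, -1 < mq f) :
    Continuous fun U : GaugeConfig 3 S (Matrix.specialUnitaryGroup (Fin 3) ℂ) =>
      (fermionSliceOp (Nf := Nf) U mq Finset.univ Finset.univ).re :=
  Complex.continuous_re.comp
    ((continuous_fermionSliceOp Nf S mq hm).matrix_elem Finset.univ Finset.univ)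

/-! ### Fock pairings of the two basis waves -/

/-- With at least one quark mode the filled state is not the vacuum: `univ ≠ ∅`. [folklore] -/
theorem univ_ne_empty [NeZero Nf] :
    (Finset.univ : Finset (SliceFermiIdx Nf S)) ≠ ∅ := by
  haveI : Nonempty (SliceQuarkVar Nf S) := ⟨(0, (fun _ => 0), 0, 0)⟩
  have hcard : 0 < Fintype.card (SliceQuarkVar Nf S) := Fintype.card_pos
  haveI : Nonempty (SliceFermiIdx Nf S) := ⟨⟨0, hcard⟩⟩
  exact Finset.univ_nonempty.ne_empty

/-- **Fock pairings of constant combinations**: `⟨x|∅⟩ + y|ι⟩, x'|∅⟩ + y'|ι⟩⟩ = conj x · x' + conj y · y'`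
(`|∅⟩`, `|ι⟩` are distinct, hence orthonormal, occupation-basis vectors). [folklore] -/
theorem star_constCombo_dotProduct [NeZero Nf] (x y x' y' : ℂ) :
    star (x • (vacuum : Fock (SliceFermiIdx Nf S)) +
          y • Pi.single (Finset.univ : Finset (SliceFermiIdx Nf S)) (1 : ℂ)) ⬝ᵥ
        (x' • (vacuum : Fock (SliceFermiIdx Nf S)) +
          y' • Pi.single (Finset.univ : Finset (SliceFermiIdx Nf S)) (1 : ℂ)) =
      star x * x' + star y * y' := by
  have hne : (Finset.univ : Finset (SliceFermiIdx Nf S)) ≠ ∅ := univ_ne_empty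
  simp only [vacuum, dotProduct, Pi.add_apply, Pi.smul_apply, Pi.single_apply, smul_eq_mul, mul_ite,
    mul_one, mul_zero, star_add, add_mul, mul_add, Finset.sum_add_distrib, Finset.sum_ite_eq',
    Finset.mem_univ, if_true]
  simp [hne, Ne.symm hne]

end FilledSliceState

/-- **The completely filled slice state is an exact, gauge-invariant eigen-wave of `T̂_F(U)`** (registered
sub-goal `filledSliceState_eigenwave` of crux stmt-QuantumFields-8892, line `pin-the-infimum`): for all bare
masses `m_f > −1`, `T̂_F(U)|ι⟩ = T̂_F(U)_{ιι}|ι⟩` with `T̂_F(U)_{ιι}` a strictly positive real number, and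
`Γ(G_g)|ι⟩ = |ι⟩` for every time-independent gauge transformation `g`. [cite: Luscher1977, pp. 283–292]
[cite: Smit2023, §6.5 (6.91)] -/
theorem filledSliceState_eigenwave : ∀ (Nf S : ℕ) [NeZero S] (U : GaugeConfig 3 S (Matrix.specialUnitaryGroup (Fin 3) ℂ)) (mq : Fin Nf → ℝ), (∀ f, -1 < mq f) → fermionSliceOp U mq *ᵥ Pi.single (Finset.univ : Finset (SliceFermiIdx Nf S)) (1 : ℂ) = (fermionSliceOp U mq Finset.univ Finset.univ) • Pi.single (Finset.univ : Finset (SliceFermiIdx Nf S)) (1 : ℂ) ∧ (0 < (fermionSliceOp U mq Finset.univ Finset.univ).re ∧ (fermionSliceOp U mq Finset.univ Finset.univ).im = 0) ∧ ∀ g : TorusSite 3 S → Matrix.specialUnitaryGroup (Fin 3) ℂ, fockGaugeAct (Nf := Nf) (S := S) g *ᵥ Pi.single (Finset.univ : Finset (SliceFermiIdx Nf S)) (1 : ℂ) = Pi.single (Finset.univ : Finset (SliceFermiIdx Nf S)) (1 : ℂ) :=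
  fun _ _ _ U mq hm => ⟨FilledSliceState.fermionSliceOp_mulVec_filled U mq,
    FilledSliceState.fermionSliceOp_univ_univ_pos U mq hm, fun g => FilledSliceState.fockGaugeAct_mulVec_filled g⟩

end Summit.QuantumFields.QCD.Cruxes.RobustYangMillsHandover.PinTheInfimum

end
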